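import Summits.ResolutionOfSingularities.ResolutionOfSingularities.Theorems.NearCutWalls
import HarnessLib

/-!
# NearCutWalls2 — decomp-res node «NearCut» (lens-3 g22, critic row 170), tree file 8/10 of the node

Content VERBATIM from the decomp-res lens-3 g22 node `HOME/decomp-res-lens-3/g22/NearCut.lean` (pin 52e91527; HOME =
run/shared/lean/pub/decomp-res); critic row 170
BOOKED 0·0; landing orders INBOX :715 / :727 — provenance, critic text and the lens header in full in the first file
of the node, `NearCutForms`.  Namespace
`…Theorems.NearCut`; `--supports stmt-ResolutionOfSingularities-31770`; linear import chain in the lens's order.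

## This file

Continuation 2/2 of `NearCutWalls` (same sections of the node, cut at the 400-line cap): carries `OffWallShedding`,
`sheddingLemma_of_offWall`, `fin3_third`, `fin3_fourth`, `walls_succ`, `ChainShedding`, `chain_hypotheses`,
`sheddingLemma_of_chainShedding`, `offWallShedding_of_chainShedding`.

[WRITER NOTE (decomp-res writer g10): file split only (tree files ≤ 400 lines); namespace blocks, sections, section
variables, `open` lines and every declaration
exactly as in the lens; the three deprecated `Finsupp.degree_add` occurrences read `map_add` (definitionally the same lemma).]

(Sources: cossart2020 (Cossart–Jannsen–Saito LNM 2270: Thm 5.40 p. 85, Defs 5.38/5.39 pp. 84–85, Thm 5.28 p. 72, Thm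
5.35 / Cor 5.37); HauserPerlega2024 (Prop. 3 p. 791); Hauser2010Kangaroo (arXiv:0811.4151); Moh1987;
CossartPiltant2008 §2; Giraud1975; Hironaka1964.)
-/

noncomputable section

open MvPolynomial Finset
open Literature.AlgebraicGeometry.Resolution
open Literature.AlgebraicGeometry.Resolution.Hauser2010
open Literature.AlgebraicGeometry.Resolution.PointBlowup
open Summit.ResolutionOfSingularities.ResolutionOfSingularities.Theses
open Summit.ResolutionOfSingularities.ResolutionOfSingularities.Theorems.TightDefectClasses
open Summit.ResolutionOfSingularities.ResolutionOfSingularities.Theorems.TightDefectStrongWalks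
open Summit.ResolutionOfSingularities.ResolutionOfSingularities.Theorems.ItineraryCutClasses
open Summit.ResolutionOfSingularities.ResolutionOfSingularities.Theorems.BoundaryLedger
open Summit.ResolutionOfSingularities.ResolutionOfSingularities.Theorems.ProximityCut
open Summit.ResolutionOfSingularities.ResolutionOfSingularities.Theorems.ConeCutAxisLaw
open Literature.AlgebraicGeometry.Resolution.WeightedBlowup
open Literature.Barriers.ResolutionOfSingularities
open Summit.ResolutionOfSingularities.ResolutionOfSingularities.Theorems.FloorCut
open Summit.ResolutionOfSingularities.ResolutionOfSingularities.Theorems.ConeCut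
open Summit.ResolutionOfSingularities.ResolutionOfSingularities.Theorems.ExitLaw (fin3_cases eq_of_le_of_degree_le)
open Summit.ResolutionOfSingularities.ResolutionOfSingularities.Theorems.ShadeCut
open Summit.ResolutionOfSingularities.ResolutionOfSingularities.Theorems.TightCut
open Summit.ResolutionOfSingularities.ResolutionOfSingularities.Theorems.HoleCut

namespace Summit.ResolutionOfSingularities.ResolutionOfSingularities.Theorems.NearCut

section WalkWalls

variable {K : Type} [Field K] [PerfectField K] [DecidableEq K]

/-- **NAMED TARGET `OffWallShedding` (classical, char-free; the only non-kernel part of the shedding lemma).**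
Along a δ-balanced plateau, for `n ≫ 0` the order-`s` locus of the companion surface `G_n` lies in the union of the two
walls `{y_{w₁} y_{w₂} = 0}` near the closed point: `∃ M g, g(0) ≠ 0 ∧ g·(y_{w₁} y_{w₂})^M ∈ multIdeal s G_n`.
Paper proof (NODE-g22 §3): an order-`s` curve of `G_n` off the walls has intersection multiplicity `Φ_n ≥ 1` with the
walls; the walk's next centre lies on the strict transform of exactly one old wall, so `Φ` strictly decreases along the
curve's strict transforms while new order-`s` curves are born only inside the exceptional wall; hence after finitely many
steps no off-wall order-`s` curve survives (surfaces of order `s` through the point are excluded by `wallIsolation`).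
[new; classical embedded-curve shedding, cf. CJS2020 §5.3, Zariski 1944] -/
def OffWallShedding : Prop :=
  ∀ p : ℕ, p.Prime → ∀ e : ℕ, 2 ≤ e →
  ∀ (K : Type) [Field K] [CharP K p] [PerfectField K] [DecidableEq K]
    (s₀ : State (Fin 3) K), IsRoot (p ^ e) s₀ → ∀ W : ForcedWalk (p ^ e) s₀,
  ∀ N : ℕ, (∀ t, N ≤ t → (W.st (t + 1)).shade = (W.st t).shade) →
    (∀ t, N ≤ t → ordZero (W.st t).F ≠ ((p ^ e : ℕ) : ℕ∞)) →
    (∀ M : ℕ, ∃ t, M ≤ t ∧ StaysOnNewest W t) →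
  ∀ s : ℕ, (W.st N).shade = (s : ℕ∞) → 2 ≤ s →
    (∀ t, N ≤ t → ((W.st t).r.degree + 2 * s = 2 * p ^ e ∧
      ∃ x, (W.st t).r x = 0 ∧ ∀ y, y ≠ x → (W.st t).r y + s = p ^ e)) →
  ∃ m₀ : ℕ, ∀ n, m₀ ≤ n → ∀ w₁ w₂ : Fin 3, w₁ ≠ w₂ → (W.st (N + n)).r w₁ = p ^ e - s →
    (W.st (N + n)).r w₂ = p ^ e - s →
    ∃ (M : ℕ) (g : MvPolynomial (Fin 3) K), constantCoeff g ≠ 0 ∧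
      g * (X w₁ * X w₂) ^ M ∈ multIdeal s (companion W N s n)

/-- **THE SHEDDING LEMMA REDUCES TO ITS OFF-WALL HALF (kernel).** [new] [folklore] -/
theorem sheddingLemma_of_offWall (hO : OffWallShedding) : SheddingLemma := by
  intro p hp e he K _ _ _ _ s₀ hroot W N hplat hbig hrec s hs h2 hbal
  classical
  obtain ⟨m₀, hm₀⟩ := hO p hp e he K s₀ hroot W N hplat hbig hrec s hs h2 hbal
  refine ⟨m₀, fun n hn => ?_⟩
  obtain ⟨w₁, w₂, hne, hw₁, hw₂⟩ := two_walls (hbal (N + n) (by omega)).2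
  obtain ⟨M₁, g₁, hg₁, hmem₁⟩ := wallIsolation hp hroot W N hplat hbig s hs hbal n w₁ hw₁
  obtain ⟨M₂, g₂, hg₂, hmem₂⟩ := wallIsolation hp hroot W N hplat hbig s hs hbal n w₂ hw₂
  obtain ⟨M₃, g₃, hg₃, hmem₃⟩ := hm₀ n hn w₁ w₂ hne hw₁ hw₂
  set M := M₁ + M₂ + M₃ with hM
  refine ⟨2 * M * M, g₃ * (g₁ * g₂) ^ M, ?_, fun i => ?_⟩
  · rw [map_mul, map_pow, map_mul]
    exact mul_ne_zero hg₃ (pow_ne_zero _ (mul_ne_zero hg₁ hg₂))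
  · exact isolatedMult_of_walls (X i) (mul_pow_mem_of_le (hmem₁ i) (by omega)) (mul_pow_mem_of_le (hmem₂ i) (by omega))
      (mul_pow_mem_of_le hmem₃ (by omega))

end WalkWalls

section WallSucc

variable {K : Type} [Field K] [PerfectField K] [DecidableEq K]

/-! ### §N5b The wall transition under a δ-balanced move (kernel bookkeeping; step (W) of the paper proof of
`OffWallShedding`, NODE-g22 §3): the chart slot becomes a wall, and exactly one old wall is KEPT with zero translation. -/

/-- `Fin 3` bookkeeping: a third index. [folklore] -/
theorem fin3_third : ∀ a b : Fin 3, ∃ k : Fin 3, k ≠ a ∧ k ≠ b := by decide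

/-- `Fin 3` bookkeeping: four indices with five inequalities. [folklore] -/
theorem fin3_fourth (a b c d : Fin 3) (hab : a ≠ b) (hac : a ≠ c) (hbc : b ≠ c) (hdb : d ≠ b) (hdc : d ≠ c) :
    d = a := by
  rw [Ne, Fin.ext_iff] at hab hac hbc hdb hdc
  rw [Fin.ext_iff]
  have := a.isLt; have := b.isLt; have := c.isLt; have := d.isLt
  omega

omit [PerfectField K] in
/-- **WALLS UNDER A BALANCED MOVE (PROVED).**  If stages `t` and `t+1` are both δ-balanced (`δ = q − s`), then the new
exponent of the chart slot is `δ` (the exceptional plane is a wall), and there is exactly one index `k ≠ j_t`, an OLD wall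
(`r_t k = δ`) with ZERO translation (`b_t k = 0`), which is the other new wall; the third slot has exponent `0`.
[new] [folklore] -/
theorem walls_succ {q : ℕ} {s₀ : State (Fin 3) K} (hroot : IsRoot q s₀) (W : ForcedWalk q s₀) (t s : ℕ)
    (hsh : (W.st t).shade = (s : ℕ∞)) (hbig : ordZero (W.st t).F ≠ (q : ℕ∞))
    (hbal : (W.st t).r.degree + 2 * s = 2 * q)
    (hbal' : (W.st (t + 1)).r.degree + 2 * s = 2 * q ∧
      ∃ x, (W.st (t + 1)).r x = 0 ∧ ∀ y, y ≠ x → (W.st (t + 1)).r y + s = q) :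
    (W.st (t + 1)).r (W.j t) = q - s ∧
      ∃ k, k ≠ W.j t ∧ (W.st t).r k = q - s ∧ W.b t k = 0 ∧ (W.st (t + 1)).r k = q - s ∧
        ∀ i, i ≠ W.j t → i ≠ k → (W.st (t + 1)).r i = 0 := by
  classical
  have hsq : s < q := lt_of_balanced hroot W t s hsh hbig hbal
  have ho := ordZero_eq_degree_add hroot W t s hsh
  have hr' : ∀ i, (W.st (t + 1)).r i
      = if i = W.j t then q - s else (if W.b t i = 0 then (W.st t).r i else 0) := by
    intro i
    rw [st_succ_r, ho, ENat.toNat_coe, Finsupp.coe_update]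
    by_cases hi : i = W.j t
    · rw [if_pos hi, hi, Function.update_self]; omega
    · rw [if_neg hi, Function.update_of_ne hi, Finsupp.filter_apply]
  obtain ⟨-, x, hx0, hx⟩ := hbal'
  have hj : (W.st (t + 1)).r (W.j t) = q - s := by rw [hr']; simp
  have hxj : x ≠ W.j t := by
    intro h; rw [h, hj] at hx0; omega
  -- the third index
  obtain ⟨k, hkj, hkx⟩ := fin3_third (W.j t) x
  have hk' : (W.st (t + 1)).r k = q - s := by have := hx k hkx; omega
  have hk2 := hr' k
  rw [hk', if_neg hkj] at hk2
  have hbk : W.b t k = 0 := by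
    by_contra h; rw [if_neg h] at hk2; omega
  rw [if_pos hbk] at hk2
  refine ⟨hj, k, hkj, hk2.symm, hbk, hk', fun i hij hik => ?_⟩
  have hix : i = x := fin3_fourth x (W.j t) k i hxj hkx.symm hkj.symm hij hik
  rw [hix, hx0]

end WallSucc

section Chain

/-! ### §N5c THE WALK-FREE FORM OF THE SHEDDING TARGET: `ChainShedding` (classical, characteristic-free statement about
a chain of point blow-ups of a surface in `𝔸³` carrying two moving coordinate WALLS), and the kernel reductions
`ChainShedding → SheddingLemma`, `ChainShedding → OffWallShedding` (via `walls_succ` + `wallIsolation`). -/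

/-- **`ChainShedding`** — the named prover target in WALK-FREE form (no shade, no cleaning, no characteristic).  DATA: a
chain `G_{n+1} = translate b_n (chartTransform s j_n G_n)` of surfaces in `𝔸³_K` of multiplicity exactly `s ≥ 2` at the
closed points, and a set of WALL SLOTS `wall n ⊆ Fin 3` at every stage such that (two) every stage has two distinct walls,
(exc) the chart slot `j_n` is a wall of stage `n+1` (the exceptional plane), (kept) every other wall of stage `n+1` is a wall
of stage `n` with zero translation (`b_n c = 0`, so `{y_c = 0}` at `n+1` is the strict transform of `{y_c = 0}` at `n`), and
(iso) at every stage the multiplicity-`s` locus of `G_n` meets every wall only at the closed point (certificate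
`g·y_i^M ∈ multIdeal s G_n + (y_c)`).  CONCLUSION: from some stage on the closed point is ISOLATED in the multiplicity-`s`
locus.  Paper proof = NODE-g22 §3 (B)(T)(C): the order-`s` locus is a finite union of off-wall curve branches; the sum `Φ`
of their intersection numbers with the walls drops by the branch multiplicity at every step; no branch is born outside
the exceptional wall.  [new; classical] -/
def ChainShedding : Prop :=
  ∀ (K : Type) [Field K] (s : ℕ), 2 ≤ s →
    ∀ (G : ℕ → MvPolynomial (Fin 3) K) (j : ℕ → Fin 3) (b : ℕ → Fin 3 → K) (wall : ℕ → Fin 3 → Prop),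
      (∀ n, b n (j n) = 0) →
      (∀ n, G (n + 1) = translate (b n) (chartTransform s (j n) (G n))) →
      (∀ n, ordZero (G n) = (s : ℕ∞)) →
      (∀ n, ∃ c₁ c₂, c₁ ≠ c₂ ∧ wall n c₁ ∧ wall n c₂) →
      (∀ n, wall (n + 1) (j n)) →
      (∀ n c, wall (n + 1) c → c ≠ j n → wall n c ∧ b n c = 0) →
      (∀ n c, wall n c → ∃ (M : ℕ) (g : MvPolynomial (Fin 3) K), constantCoeff g ≠ 0 ∧
        ∀ i, g * X i ^ M ∈ multIdeal s (G n) ⊔ Ideal.span {X c}) →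
      ∃ m₀ : ℕ, ∀ n, m₀ ≤ n → IsolatedMult s (G n)

variable {K : Type} [Field K] [PerfectField K] [DecidableEq K]

omit [PerfectField K] in
/-- The companion chain of a δ-balanced plateau, with `wall n c := (r_{N+n} c = q − s)`, satisfies the hypotheses
(two)/(exc)/(kept)/(iso) of `ChainShedding` — by `two_walls`, `walls_succ` and `wallIsolation` (kernel). [new] [folklore] -/
theorem chain_hypotheses {p e : ℕ} (hp : p.Prime) [CharP K p] {s₀ : State (Fin 3) K} (hroot : IsRoot (p ^ e) s₀)
    (W : ForcedWalk (p ^ e) s₀) (N : ℕ) (hplat : ∀ t, N ≤ t → (W.st (t + 1)).shade = (W.st t).shade)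
    (hbig : ∀ t, N ≤ t → ordZero (W.st t).F ≠ ((p ^ e : ℕ) : ℕ∞)) (s : ℕ) (hs : (W.st N).shade = (s : ℕ∞))
    (hbal : ∀ t, N ≤ t → ((W.st t).r.degree + 2 * s = 2 * p ^ e ∧
      ∃ x, (W.st t).r x = 0 ∧ ∀ y, y ≠ x → (W.st t).r y + s = p ^ e)) :
    (∀ n, ∃ c₁ c₂, c₁ ≠ c₂ ∧ (W.st (N + n)).r c₁ = p ^ e - s ∧ (W.st (N + n)).r c₂ = p ^ e - s) ∧
    (∀ n, (W.st (N + (n + 1))).r (W.j (N + n)) = p ^ e - s) ∧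
    (∀ n c, (W.st (N + (n + 1))).r c = p ^ e - s → c ≠ W.j (N + n) →
      (W.st (N + n)).r c = p ^ e - s ∧ W.b (N + n) c = 0) ∧
    (∀ n c, (W.st (N + n)).r c = p ^ e - s → ∃ (M : ℕ) (g : MvPolynomial (Fin 3) K), constantCoeff g ≠ 0 ∧
      ∀ i, g * X i ^ M ∈ multIdeal s (companion W N s n) ⊔ Ideal.span {X c}) := by
  have hshade := shade_of_plateau W N s hplat hs
  have hsucc : ∀ n, (W.st (N + n + 1)).r (W.j (N + n)) = p ^ e - s ∧
      ∃ k, k ≠ W.j (N + n) ∧ (W.st (N + n)).r k = p ^ e - s ∧ W.b (N + n) k = 0 ∧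
        (W.st (N + n + 1)).r k = p ^ e - s ∧ ∀ i, i ≠ W.j (N + n) → i ≠ k → (W.st (N + n + 1)).r i = 0 :=
    fun n => walls_succ hroot W (N + n) s (hshade _ (by omega)) (hbig _ (by omega)) (hbal _ (by omega)).1
      (hbal _ (by omega))
  refine ⟨fun n => two_walls (hbal (N + n) (by omega)).2, fun n => (hsucc n).1, fun n c hc hcj => ?_,
    fun n c hc => wallIsolation hp hroot W N hplat hbig s hs hbal n c hc⟩
  obtain ⟨-, k, hkj, hrk, hbk, hrk', hzero⟩ := hsucc n
  have hsq : s < p ^ e :=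
    lt_of_balanced hroot W (N + n) s (hshade _ (by omega)) (hbig _ (by omega)) (hbal _ (by omega)).1
  have hck : c = k := by
    by_contra h
    have := hzero c hcj h
    rw [show N + (n + 1) = N + n + 1 from rfl] at hc
    omega
  subst hck
  exact ⟨hrk, hbk⟩

omit [PerfectField K] [DecidableEq K] in
/-- **`ChainShedding → SheddingLemma` (kernel).**  Feed the companion chain with its exponent walls. [new] [folklore] -/
theorem sheddingLemma_of_chainShedding (hC : ChainShedding) : SheddingLemma := by
  intro p hp e he K _ _ _ _ s₀ hroot W N hplat hbig hrec s hs h2 hbal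
  classical
  obtain ⟨htwo, hexc, hkept, hiso⟩ := chain_hypotheses hp hroot W N hplat hbig s hs hbal
  have hnear : ∀ n, ordZero (companion W N s n) = (s : ℕ∞) :=
    fun n => (companionLaw p hp e he K s₀ hroot W N hplat hbig s hs h2 hbal n).1
  exact hC K s h2 (companion W N s) (fun n => W.j (N + n)) (fun n => W.b (N + n))
    (fun n c => (W.st (N + n)).r c = p ^ e - s) (fun n => W.onExc _) (fun n => companion_succ W N s n) hnear
    htwo hexc hkept hiso

omit [PerfectField K] [DecidableEq K] in
/-- **`ChainShedding → OffWallShedding` (kernel).** [new] [folklore] -/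
theorem offWallShedding_of_chainShedding (hC : ChainShedding) : OffWallShedding := by
  intro p hp e he K _ _ _ _ s₀ hroot W N hplat hbig hrec s hs h2 hbal
  obtain ⟨m₀, hm₀⟩ := sheddingLemma_of_chainShedding hC p hp e he K s₀ hroot W N hplat hbig hrec s hs h2 hbal
  refine ⟨m₀, fun n hn w₁ w₂ _ _ _ => ?_⟩
  obtain ⟨M, g, hg, hmem⟩ := hm₀ n hn
  refine ⟨M, g, hg, ?_⟩
  rw [mul_pow, ← mul_assoc]
  exact Ideal.mul_mem_right _ _ (hmem w₁)

end Chain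

end Summit.ResolutionOfSingularities.ResolutionOfSingularities.Theorems.NearCut
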